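import Mathlib
import Summits.Ventures.PercRepro2.KPrimeReduction
import Summits.Ventures.PercRepro2.KPrimeSure

/-!
# `(K′)` = BHK part + glue − covariance: the only unsigned piece of `(K′)` is the covariance term
(blind cell PercRepro2, mine-c g36; `conjectures/MINE-C.md` §45.0)

The cleared `(K′)` form of `KPrimeReduction.lean` splits, for every threshold pair `(N₀, D₀)`, as

  `form = P(S)·(D₀·P((0,1) ∩ X) − N₀·P((0,1))) + P(S)·D₀·P((0,1) ∩ Xᶜ ∩ {v ↔ b}) − cov`,

  `cov := P(S)·(P(U∩Y∩X∩Ω)·D₀ − N₀·P(U∩Y∩Ω)) − (P(U∩X∩Ω)·D₀ − N₀·P(U∩Ω))·P(Y∩S)`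

(`kprimeForm_split`; `cov = D₀·P(S)²·Cov_S(u(X − E₀), Y)` is the covariance term of the
`(K′)` functional, `(0,1) = {v ∉ C₁, y ∈ C₁, a₂ ↮ {a₁, v}}`, `X = {b ∈ C₁}`).  At the lean
`(N₀, D₀) = (P(X ∩ N), P(N))` the first piece is `≥ 0` by van den Berg–Häggström–Kahn for the
cluster of `a₁` under the avoidance `a₁ ↮ {a₂, v}` (`bhk_induced` with the monotone functionals
`1[y ∈ K]·P(a₂ ↮ v in G ∖ K)` and `1[b ∈ K]`: `bhk_part_ineq`), and the second is a probability.
Hence **`(K′)` holds whenever the covariance term is `≤ 0`** (`kprimeHolds_of_covTerm_nonpos`), in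
particular whenever `P(Y ∩ S) = 0` — `a₂` cannot reach `y` in `S` (`kprimeHolds_of_YS_eq_zero`).
This is the kernel form of the reading of `MINE-C.md` §45.0: the three `R`-pockets of §44.5–44.7
have `cov = 0` exactly, so `(K′)` and `(STEP-v)₁` are trivially true there.
-/

namespace Summit.Ventures.PercRepro2

namespace KPrime

variable {V : Type*} {E : Type*} [Fintype E] [DecidableEq E] [Fintype V] [DecidableEq V]
  {R : Type*} [Field R] [LinearOrder R] [IsStrictOrderedRing R]

section Split

variable (ends : E → Sym2 V) (a₁ a₂ b v y : V)

/-- The GLUE class: `v` free, `y ∈ C₁`, `b ∉ C₁`, `b ∈ C(v)`. -/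
def glueCls : Set (Config E) :=
  cls01 ends a₁ a₂ v y ∩ (connEvent ends a₁ b)ᶜ ∩ connEvent ends v b

/-- The COVARIANCE piece of the cleared `(K′)` form at the threshold pair `(N₀, D₀)`:
`P(S)·(P(U∩Y∩X∩Ω)·D₀ − N₀·P(U∩Y∩Ω)) − (P(U∩X∩Ω)·D₀ − N₀·P(U∩Ω))·P(Y∩S)`
(`= D₀·P(S)²·Cov_S(u(X − E₀), Y)` at `E₀ = N₀/D₀`). -/
noncomputable def covTerm (p : E → R) (N₀ D₀ : R) : R :=
  prob p (S ends a₁ a₂ v) *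
      (prob p (connEvent ends a₁ v ∩ connEvent ends a₂ y ∩ connEvent ends a₁ b ∩ Ω ends a₁ a₂) * D₀ -
        N₀ * prob p (connEvent ends a₁ v ∩ connEvent ends a₂ y ∩ Ω ends a₁ a₂)) -
    (prob p (connEvent ends a₁ v ∩ connEvent ends a₁ b ∩ Ω ends a₁ a₂) * D₀ -
        N₀ * prob p (connEvent ends a₁ v ∩ Ω ends a₁ a₂)) *
      prob p (connEvent ends a₂ y ∩ S ends a₁ a₂ v)

omit [Fintype E] [DecidableEq E] [Fintype V] in
/-- `(0,1)ᵉ = ((0,1) ∩ X) ∪ glue`. -/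
lemma cls01e_eq_union :
    cls01e ends a₁ a₂ b v y =
      cls01 ends a₁ a₂ v y ∩ connEvent ends a₁ b ∪ glueCls ends a₁ a₂ b v y := by
  ext ω
  simp only [cls01e, cls01, glueCls, Set.mem_union, Set.mem_inter_iff, Set.mem_compl_iff]
  tauto

omit [Fintype E] [DecidableEq E] [Fintype V] in
/-- `(0,1) ∩ X` and the glue class are disjoint. -/
lemma disjoint_cls01_glue :
    Disjoint (cls01 ends a₁ a₂ v y ∩ connEvent ends a₁ b) (glueCls ends a₁ a₂ b v y) := by
  rw [Set.disjoint_left]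
  intro ω h1 h2
  simp only [glueCls, Set.mem_inter_iff, Set.mem_compl_iff] at h1 h2
  exact h2.1.2 h1.2

omit [Fintype V] [LinearOrder R] [IsStrictOrderedRing R] in
/-- `P((0,1)ᵉ) = P((0,1) ∩ X) + P(glue)`. -/
lemma prob_cls01e_split (p : E → R) :
    prob p (cls01e ends a₁ a₂ b v y) =
      prob p (cls01 ends a₁ a₂ v y ∩ connEvent ends a₁ b) + prob p (glueCls ends a₁ a₂ b v y) := by
  rw [cls01e_eq_union, prob_union_of_disjoint p (disjoint_cls01_glue ends a₁ a₂ b v y)]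

omit [Fintype V] [LinearOrder R] [IsStrictOrderedRing R] in
/-- **The split of the cleared `(K′)` form**: BHK part + glue − covariance, for every threshold
pair `(N₀, D₀)`. -/
theorem kprimeForm_split (p : E → R) (N₀ D₀ : R) :
    kprimeForm ends a₁ a₂ b v y p N₀ D₀ =
      prob p (S ends a₁ a₂ v) *
          (D₀ * prob p (cls01 ends a₁ a₂ v y ∩ connEvent ends a₁ b) -
            N₀ * prob p (cls01 ends a₁ a₂ v y)) +
        prob p (S ends a₁ a₂ v) * D₀ * prob p (glueCls ends a₁ a₂ b v y) -
        covTerm ends a₁ a₂ b v y p N₀ D₀ := by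
  unfold kprimeForm covTerm
  rw [prob_cls01e_split]
  ring

end Split

/-! ## The BHK part is non-negative at the lean `(P(X ∩ N), P(N))` -/

section BHKPart

variable {p : E → R} {ends : E → Sym2 V} {a₁ a₂ b v y : V}

omit [Fintype V] [DecidableEq V] in
/-- For a DOWN-set `𝓥`, `g(W) = P(C_t ∈ 𝓥 in G ∖ W)` is monotone in `W`. -/
lemma delClusterProb_mono (hp : IsProbVec p) (t : V) {𝓥 : Set (Set V)} (h𝓥 : IsLowerSet 𝓥) :
    Monotone (delClusterProb p ends t 𝓥) := by
  intro W W' h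
  unfold delClusterProb
  refine prob_mono hp fun ω hω => ?_
  exact h𝓥 (cluster_mono (delConfig_anti h ω) t) hω

omit [Fintype E] [DecidableEq E] [Fintype V] [DecidableEq V] in
/-- `{C(a₂) ∌ v} = {a₂ ↮ v}`. -/
lemma clusterInEvent_notMem_eq :
    clusterInEvent ends a₂ {L : Set V | v ∉ L} = (connEvent ends a₂ v)ᶜ := by
  ext ω
  simp only [mem_clusterInEvent, Set.mem_setOf_eq, mem_cluster, Set.mem_compl_iff, mem_connEvent]

omit [Fintype E] [DecidableEq E] [Fintype V] [DecidableEq V] in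
/-- `{L | v ∉ L}` is a down-set. -/
lemma isLowerSet_notMem : IsLowerSet {L : Set V | v ∉ L} := fun _ _ hST h hv => h (hST hv)

omit [Fintype E] [DecidableEq E] [Fintype V] in
/-- `(0,1) = {y ∈ C₁} ∩ {a₂ ↮ v} ∩ N`. -/
lemma cls01_eq_inter :
    cls01 ends a₁ a₂ v y =
      connEvent ends a₁ y ∩ (connEvent ends a₂ v)ᶜ ∩ N ends a₁ a₂ v := by
  ext ω
  simp only [cls01, Set.mem_inter_iff, Set.mem_compl_iff, mem_connEvent, mem_S, mem_N]
  constructor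
  · rintro ⟨⟨h1, h2⟩, h3, h4⟩
    exact ⟨⟨h2, h4⟩, fun h => h3 (conn_symm h), h1⟩
  · rintro ⟨⟨h2, h4⟩, h3, h1⟩
    exact ⟨⟨h1, h2⟩, fun h => h3 (conn_symm h), h4⟩

omit [Fintype E] [DecidableEq E] [Fintype V] [DecidableEq V] in
/-- `{C(a₁) ∈ 𝓤 ∩ 𝓤'} = {C(a₁) ∈ 𝓤} ∩ {C(a₁) ∈ 𝓤'}`. -/
lemma clusterInEvent_inter (x : V) (𝓤 𝓤' : Set (Set V)) :
    clusterInEvent ends x (𝓤 ∩ 𝓤') = clusterInEvent ends x 𝓤 ∩ clusterInEvent ends x 𝓤' := by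
  ext ω
  simp only [mem_clusterInEvent, Set.mem_inter_iff]

/-- **The BHK part of `(K′)` is signed** (van den Berg–Häggström–Kahn for the cluster of `a₁`
under the avoidance `a₁ ↮ {a₂, v}`, functional form `bhk_induced` with `F₁ = 1[y ∈ K]·P(a₂ ↮ v in
G ∖ K)` and `F₂ = 1[b ∈ K]`):
`P((0,1)) · P(X ∩ N) ≤ P((0,1) ∩ X) · P(N)`, i.e. `P(b ∈ C₁ | (0,1)) ≥ P(b ∈ C₁ | N) = E₀`. -/
theorem bhk_part_ineq (hp : IsProbVec p) :
    prob p (cls01 ends a₁ a₂ v y) * prob p (connEvent ends a₁ b ∩ N ends a₁ a₂ v) ≤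
      prob p (cls01 ends a₁ a₂ v y ∩ connEvent ends a₁ b) * prob p (N ends a₁ a₂ v) := by
  classical
  set 𝓥 : Set (Set V) := {L : Set V | v ∉ L} with h𝓥def
  set 𝓤y : Set (Set V) := {K : Set V | y ∈ K} with h𝓤y
  set 𝓤b : Set (Set V) := {K : Set V | b ∈ K} with h𝓤b
  set g := delClusterProb p ends a₂ 𝓥 with hg
  have hg_mono : Monotone g := delClusterProb_mono hp a₂ (isLowerSet_notMem (v := v))
  have hg0 : ∀ W, 0 ≤ g W := delClusterProb_nonneg p hp ends a₂ 𝓥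
  have ha₂ : a₂ ∈ ({a₂, v} : Finset V) := by simp
  -- the three expectations as probabilities
  have eY := prob_clusterIn_inter_avoid_eq_expect p ends a₁ a₂ ha₂ 𝓤y 𝓥
  have eYB := prob_clusterIn_inter_avoid_eq_expect p ends a₁ a₂ ha₂ (𝓤y ∩ 𝓤b) 𝓥
  have eB := prob_clusterInEvent_inter_eq_expect p ends a₁ 𝓤b (avoidAll ends a₁ {a₂, v})
  -- the functional BHK inequality
  have hF₁ : Monotone (fun K : Set V => 𝓤y.indicator (1 : Set V → R) K * g K) := by
    intro K K' h
    have h1 := monotone_indicator_one_of_isUpperSet (R := R) (isUpperSet_mem y) h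
    have h2 := hg_mono h
    have h3 : 0 ≤ 𝓤y.indicator (1 : Set V → R) K := Set.indicator_apply_nonneg fun _ => zero_le_one
    exact mul_le_mul h1 h2 (hg0 K) (le_trans h3 h1)
  have hF₂ : Monotone (𝓤b.indicator (1 : Set V → R)) :=
    monotone_indicator_one_of_isUpperSet (isUpperSet_mem b)
  have hF₁0 : ∀ K, 0 ≤ 𝓤y.indicator (1 : Set V → R) K * g K := fun K =>
    mul_nonneg (Set.indicator_apply_nonneg fun _ => zero_le_one) (hg0 K)
  have hF₂0 : ∀ K, 0 ≤ 𝓤b.indicator (1 : Set V → R) K :=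
    fun K => Set.indicator_apply_nonneg fun _ => zero_le_one
  have key := bhk_induced p hp ends a₁ hF₁ hF₂ hF₁0 hF₂0 Finset.univ {a₂, v} {a₂, v}
    (Finset.subset_univ _) (Finset.subset_univ _)
  simp only [Finset.inter_self, Finset.union_self, REvent_univ] at key
  have e : ∀ F : Set V → R,
      clusterObs ends Finset.univ a₁ F * (avoidAll ends a₁ {a₂, v}).indicator 1 =
        fun ω => F (cluster ends ω a₁) * (avoidAll ends a₁ {a₂, v}).indicator 1 ω := by
    intro F
    funext ω
    simp only [Pi.mul_apply, clusterObs_apply, clusterIn_univ]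
  rw [e, e, e] at key
  simp only [Pi.mul_apply] at key
  have e3 : (fun ω => 𝓤y.indicator (1 : Set V → R) (cluster ends ω a₁) * g (cluster ends ω a₁) *
      𝓤b.indicator 1 (cluster ends ω a₁) * (avoidAll ends a₁ {a₂, v}).indicator 1 ω) =
      fun ω => (𝓤y ∩ 𝓤b).indicator (1 : Set V → R) (cluster ends ω a₁) * g (cluster ends ω a₁) *
        (avoidAll ends a₁ {a₂, v}).indicator 1 ω := by
    funext ω
    rw [Set.inter_indicator_one]
    simp only [Pi.mul_apply]
    ring
  rw [e3, ← eYB, ← eY, ← eB] at key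
  -- translate the cluster events
  have s1 : clusterInEvent ends a₁ 𝓤y ∩ clusterInEvent ends a₂ 𝓥 ∩ avoidAll ends a₁ {a₂, v} =
      cls01 ends a₁ a₂ v y := by
    rw [cls01_eq_inter, h𝓤y, h𝓥def, clusterInEvent_mem_eq, clusterInEvent_notMem_eq]
    rfl
  have s2 : clusterInEvent ends a₁ (𝓤y ∩ 𝓤b) ∩ clusterInEvent ends a₂ 𝓥 ∩
      avoidAll ends a₁ {a₂, v} = cls01 ends a₁ a₂ v y ∩ connEvent ends a₁ b := by
    rw [cls01_eq_inter, clusterInEvent_inter, h𝓤y, h𝓤b, h𝓥def, clusterInEvent_mem_eq,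
      clusterInEvent_mem_eq, clusterInEvent_notMem_eq]
    ext ω
    simp only [N, Set.mem_inter_iff]
    tauto
  have s3 : clusterInEvent ends a₁ 𝓤b ∩ avoidAll ends a₁ {a₂, v} =
      connEvent ends a₁ b ∩ N ends a₁ a₂ v := by
    rw [h𝓤b, clusterInEvent_mem_eq]
    rfl
  rw [s1, s2, s3] at key
  simpa only [N] using key

end BHKPart

/-! ## `(K′)` holds whenever the covariance term is `≤ 0` -/

section Consequences

variable {p : E → R} {ends : E → Sym2 V} {a₁ a₂ b v y : V}

/-- **`(K′)` holds whenever its covariance term is `≤ 0`** at the lean `(P(X ∩ N), P(N))`: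
the BHK part and the glue part of `kprimeForm_split` are both `≥ 0`. -/
theorem kprimeHolds_of_covTerm_nonpos (hp : IsProbVec p)
    (hcov : covTerm ends a₁ a₂ b v y p (prob p (connEvent ends a₁ b ∩ N ends a₁ a₂ v))
      (prob p (N ends a₁ a₂ v)) ≤ 0) :
    KPrimeHolds ends a₁ a₂ b v y p := by
  unfold KPrimeHolds
  rw [kprimeForm_split]
  have h1 := bhk_part_ineq (p := p) (ends := ends) (a₁ := a₁) (a₂ := a₂) (b := b) (v := v)
    (y := y) hp
  have hS := prob_nonneg hp (S ends a₁ a₂ v)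
  have hN := prob_nonneg hp (N ends a₁ a₂ v)
  have hG := prob_nonneg hp (glueCls ends a₁ a₂ b v y)
  have hbhk : 0 ≤ prob p (N ends a₁ a₂ v) *
      prob p (cls01 ends a₁ a₂ v y ∩ connEvent ends a₁ b) -
      prob p (connEvent ends a₁ b ∩ N ends a₁ a₂ v) * prob p (cls01 ends a₁ a₂ v y) := by
    linarith [h1]
  have h2 : 0 ≤ prob p (S ends a₁ a₂ v) * (prob p (N ends a₁ a₂ v) *
      prob p (cls01 ends a₁ a₂ v y ∩ connEvent ends a₁ b) -
      prob p (connEvent ends a₁ b ∩ N ends a₁ a₂ v) * prob p (cls01 ends a₁ a₂ v y)) :=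
    mul_nonneg hS hbhk
  have h3 : 0 ≤ prob p (S ends a₁ a₂ v) * prob p (N ends a₁ a₂ v) *
      prob p (glueCls ends a₁ a₂ b v y) := mul_nonneg (mul_nonneg hS hN) hG
  linarith [h2, h3, hcov]

omit [Fintype E] [DecidableEq E] [Fintype V] in
/-- `U ∩ Y ∩ Ω ⊆ Y ∩ S`. -/
lemma UYΩ_subset_YS :
    connEvent ends a₁ v ∩ connEvent ends a₂ y ∩ Ω ends a₁ a₂ ⊆
      connEvent ends a₂ y ∩ S ends a₁ a₂ v := by
  intro ω h
  simp only [Set.mem_inter_iff, mem_connEvent, mem_Ω, mem_S] at h ⊢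
  exact ⟨h.1.2, fun h' => h.2 (conn_symm h'), fun h' => h.2 (conn_trans h.1.1 (conn_symm h'))⟩

/-- **`(K′)` holds whenever `a₂` cannot reach `y` inside `S`** (`P(Y ∩ S) = 0`): the covariance
term vanishes, and `(K′)` is the one-root statement «BHK part + glue ≥ 0». -/
theorem kprimeHolds_of_YS_eq_zero (hp : IsProbVec p)
    (hYS : prob p (connEvent ends a₂ y ∩ S ends a₁ a₂ v) = 0) :
    KPrimeHolds ends a₁ a₂ b v y p := by
  apply kprimeHolds_of_covTerm_nonpos hp
  unfold covTerm
  have hD : prob p (connEvent ends a₁ v ∩ connEvent ends a₂ y ∩ Ω ends a₁ a₂) = 0 := by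
    apply le_antisymm _ (prob_nonneg hp _)
    rw [← hYS]
    exact prob_mono hp UYΩ_subset_YS
  have hC : prob p (connEvent ends a₁ v ∩ connEvent ends a₂ y ∩ connEvent ends a₁ b ∩
      Ω ends a₁ a₂) = 0 := by
    apply le_antisymm _ (prob_nonneg hp _)
    rw [← hD]
    refine prob_mono hp fun ω h => ?_
    simp only [Set.mem_inter_iff] at h ⊢
    exact ⟨⟨h.1.1.1, h.1.1.2⟩, h.2⟩
  rw [hYS, hD, hC]
  simp

end Consequences

end KPrime

end Summit.Ventures.PercRepro2
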